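import Mathlib
import Summits.NavierStokesRegularity.NavierStokesRegularity.Theorems.FilamentSkeletonRssStadiumCornerLeft

/-!
# Route `FilamentSkeletonRss` · child crux `TangentSkeletonNearStraightL` (stmt-NavierStokesRegularity-23320) · registered line
# `child_tangent_analytic_strip_L` (b0b56c52900dd90a), stub `stub_stripPropagation` — assembly: LONG PLATEAU CHORDS TO THE LEFT, TWO-SIDED

`Theorems.StadiumCornerLeft.corner_left_plateau_re_ge` certifies plateau chords `ℓ ≥ hs/2` to the left of a corner target with the source in the
RIGHT half (`cc ≤ x₀ − ℓ`); its proof only uses that the near half of the chord stays within `L + hs/4` of the centre and the far half within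
`L + hs/25`.  Here the same two-level step estimate (radii `3hs/4`, `24hs/25`, levels `1/2`, `29/100`) is stated for EVERY source of the long left
plateau down to `cc − L − hs/25` (`plateau_left_chord_re_ge`: `ℓ²·(3/20) ≤ Re Σᵢ (Fᵢ(z − ℓ) − Fᵢ(z))²`, `Rb ≤ 1/2`) — the pointwise input for the
long plateau of the quarter-width contour (sources nearer the left end are `Theorems.StadiumCornerFarSource`).
HONEST FRAMING: bookkeeping for a HYPOTHETICAL filament skeleton on the NEGATIVE side of a MODEL route; the stub `stub_stripPropagation` is NOT
closed by this file; nothing here bears on Navier–Stokes regularity or blow-up.  `--supports stmt-NavierStokesRegularity-23320`.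
-/

set_option linter.dupNamespace false

noncomputable section

namespace Summit.NavierStokesRegularity.NavierStokesRegularity.Theorems.StadiumPlateauLeftLong

open Set MeasureTheory Finset
open scoped InnerProductSpace BigOperators
open Summit.NavierStokesRegularity.NavierStokesRegularity.Theorems.StadiumPlateauStepChord
open Summit.NavierStokesRegularity.NavierStokesRegularity.Theorems.StadiumLogBounds
open Summit.NavierStokesRegularity.NavierStokesRegularity.Theorems.StadiumCornerLeft

/-- **Long plateau chords to the left, two-sided (source anywhere down to `cc − L − hs/25`), with numbers.**  Stadium `S`, `F` holomorphic on `S` with `‖F′‖ ≤ 2`, `Σ (F′)ᵢ² = 1`,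
`F = cplx ∘ X` on the real trace, `X` differentiable with unit speed and tangent oscillation `≤ Rb ≤ 1/2`; a target `z = x₀ + iY` with
`0 ≤ Y < hs/4`, `x₀ < cc + L + hs/4`, and a plateau chord of length `ℓ ≥ hs/2` to the left with `cc − L − hs/25 < x₀ − ℓ`.  Then
`ℓ²·(3/20) ≤ Re Σᵢ (Fᵢ(z − ℓ) − Fᵢ(z))²`. [folklore] -/
theorem plateau_left_chord_re_ge {hs L cc : ℝ} {F : ℂ → (Fin 3 → ℂ)}
    (hF : DifferentiableOn ℂ F {z : ℂ | |z.im| < hs ∧ |z.re - cc| < L + hs})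
    (hM : ∀ z ∈ {z : ℂ | |z.im| < hs ∧ |z.re - cc| < L + hs}, ‖deriv F z‖ ≤ 2)
    (hunit : ∀ w ∈ {z : ℂ | |z.im| < hs ∧ |z.re - cc| < L + hs}, ∑ i, (deriv F w i) ^ 2 = 1)
    {X : ℝ → EuclideanSpace ℝ (Fin 3)} (hX : Differentiable ℝ X) (hXu : ∀ τ, ‖deriv X τ‖ = 1)
    {Rb : ℝ} (hRb0 : 0 ≤ Rb) (hRb : Rb ≤ 1 / 2) (hosc : ∀ τ σ, ‖deriv X τ - deriv X σ‖ ≤ Rb)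
    (hFX : ∀ r : ℝ, (r : ℂ) ∈ {z : ℂ | |z.im| < hs ∧ |z.re - cc| < L + hs} →
      F r = fun i => ((⟪X r, EuclideanSpace.single i (1:ℝ)⟫_ℝ : ℝ) : ℂ))
    (hhs : 0 < hs) {x₀ Y ℓ : ℝ} (hY0 : 0 ≤ Y) (hY : Y < hs / 4) (hx₀ : x₀ < cc + L + hs / 4)
    (hℓ : hs / 2 ≤ ℓ) (hleft : cc - L - hs / 25 < x₀ - ℓ) :
    ℓ ^ 2 * (3 / 20) ≤
      (∑ i, (F (((x₀ : ℂ) + (Y : ℂ) * Complex.I) + ((-ℓ : ℝ) : ℂ)) i - F ((x₀ : ℂ) + (Y : ℂ) * Complex.I) i) ^ 2).re := by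
  -- radii and levels
  have hR₁Y : Y < 3 * hs / 4 := by linarith
  have hR₁hs : 3 * hs / 4 < hs := by linarith
  have hR₂Y : Y < 24 * hs / 25 := by linarith
  have hR₂hs : 24 * hs / 25 < hs := by linarith
  have hℓ0 : 0 ≤ ℓ := by linarith
  have hnear : ∀ r ∈ Icc (0:ℝ) 1, r ≤ 1 / 2 → |x₀ + r * (-ℓ) - cc| + 3 * hs / 4 < L + hs := by
    intro r hr hr2
    have hrl : r * ℓ ≤ ℓ / 2 := by nlinarith
    have hrl0 : 0 ≤ r * ℓ := mul_nonneg hr.1 hℓ0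
    have hab : |x₀ + r * (-ℓ) - cc| < L + hs / 4 := abs_lt.2 ⟨by linarith, by linarith⟩
    linarith
  have hfar : ∀ r ∈ Icc (0:ℝ) 1, 1 / 2 < r → |x₀ + r * (-ℓ) - cc| + 24 * hs / 25 < L + hs := by
    intro r hr hr2
    have hrl : ℓ / 2 ≤ r * ℓ := by nlinarith
    have hrl1 : r * ℓ ≤ ℓ := by nlinarith [hr.2]
    have hab : |x₀ + r * (-ℓ) - cc| < L + hs / 25 := abs_lt.2 ⟨by linarith, by linarith⟩
    linarith
  -- the level at `R₁ = 3hs/4`: monotone in `Y`, value `log(3/2) − 1/3` at `hs/4`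
  have h3 := sqrt_three_lt
  have hs3 : 0 ≤ Real.sqrt 3 := Real.sqrt_nonneg 3
  have hE₁ : √3 * (2 * 2 * (Real.log (3 * hs / 4 / (3 * hs / 4 - Y)) - Y / (3 * hs / 4))) ≤ 1 / 2 := by
    have hm := log_ratio_sub_mono (R := 3 * hs / 4) hY0 hY.le (by linarith : hs / 4 < 3 * hs / 4)
    have e : 3 * hs / 4 / (3 * hs / 4 - hs / 4) = 3 / 2 := by field_simp; ring
    have e2 : hs / 4 / (3 * hs / 4) = 1 / 3 := by field_simp
    rw [e, e2] at hm
    have hc := corner_profile_ratio_three_four.1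
    have hnn : 0 ≤ Real.log (3 * hs / 4 / (3 * hs / 4 - Y)) - Y / (3 * hs / 4) := by
      have h0 := log_ratio_sub_mono (R := 3 * hs / 4) le_rfl hY0 hR₁Y
      simp only [sub_zero, div_self (by positivity : (3 * hs / 4) ≠ 0), Real.log_one, zero_div] at h0
      linarith
    nlinarith
  -- the level at `R₂ = 24hs/25`: value `log(96/71) − 25/96` at `hs/4`
  have hE₂ : √3 * (2 * 2 * (Real.log (24 * hs / 25 / (24 * hs / 25 - Y)) - Y / (24 * hs / 25))) ≤ 29 / 100 := by
    have hm := log_ratio_sub_mono (R := 24 * hs / 25) hY0 hY.le (by linarith : hs / 4 < 24 * hs / 25)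
    have e : 24 * hs / 25 / (24 * hs / 25 - hs / 4) = 96 / 71 := by field_simp; ring
    have e2 : hs / 4 / (24 * hs / 25) = 25 / 96 := by field_simp; norm_num
    rw [e, e2] at hm
    have hc := log_96_71_le
    have hnn : 0 ≤ Real.log (24 * hs / 25 / (24 * hs / 25 - Y)) - Y / (24 * hs / 25) := by
      have h0 := log_ratio_sub_mono (R := 24 * hs / 25) le_rfl hY0 hR₂Y
      simp only [sub_zero, div_self (by positivity : (24 * hs / 25) ≠ 0), Real.log_one, zero_div] at h0
      linarith
    nlinarith
  have h := plateau_step_chord_re_ge hF hM hunit hX hXu hosc hFX hhs hY0 hR₁Y hR₁hs hR₂Y hR₂hs hnear hfar hE₁ hE₂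
  -- the bracket with `Rb ≤ 1/2`, `E₁ = 1/2`, `E₂ = 29/100` is at most `17/20`
  have hbr : ((Rb + 2 * (1 / 2 : ℝ)) ^ 2 + 2 * (Rb + 1 / 2 + 29 / 100) ^ 2 + (Rb + 2 * (29 / 100)) ^ 2) / 8 ≤ 17 / 20 := by
    nlinarith
  have hℓ2 : 0 ≤ ℓ ^ 2 := sq_nonneg ℓ
  calc ℓ ^ 2 * (3 / 20) ≤ ℓ ^ 2 * (1 - ((Rb + 2 * (1 / 2 : ℝ)) ^ 2 + 2 * (Rb + 1 / 2 + 29 / 100) ^ 2 +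
        (Rb + 2 * (29 / 100)) ^ 2) / 8) := mul_le_mul_of_nonneg_left (by linarith) hℓ2
    _ ≤ _ := h

end Summit.NavierStokesRegularity.NavierStokesRegularity.Theorems.StadiumPlateauLeftLong

end
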